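import Literature.Topology.FourManifolds.ToricBlowupProjectivePlane
import Literature.Topology.FourManifolds.InvertedGermExtension
import Mathlib.Geometry.Manifold.MFDeriv.Atlas

/-!
# The affine pair `(ℂℙ², line)`, I: the chart `Ψ` and the blow-down coordinates `Θ`

Support file for item stmt-SmoothPoincare4-14052 (`SymplecticOrigami.McDuffWendlAffinePair`).
The route item (= the named fact `Literature.Geometry.Symplectic.mcduffWendl_plusOneSphere_affinePair`)
asserts, for a closed symplectic `4`-manifold `N` with a symplectic `(+1)`-sphere `b(S)` (under
`rank H₂(N) = 1`, `H₁(N ∖ b(S)) = 0`), an AFFINE PAIR STRUCTURE: maps `Ψ Θ : N → ℝ⁴` and an open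
`W ⊇ b(S)` with `Ψ` a diffeomorphism of the complement onto `ℝ⁴`, `Θ` smooth on `W`,
`Θ = ι ∘ Ψ` off `b(S)` (`ι` = `sphereInversion`) and `Θ = 0`, `dim ker dΘ = 2` on `b(S)`.
The PRINTED theorem (McDuff 1990, Thm. 1.4 + Cor. 1.5 (i); Wendl 2018, Thm. D (2)) says that
`(N, b(S))` is diffeomorphic to `(ℂℙ², line)`; the affine pair structure is that of the model,
transported. This file and its sequel (`…AffinePairKernel.lean`) PROVE the affine pair structure
of the model pair `(ℂℙ², L)`, `L = {[v] | v₂ = 0}`, over the tree's `ComplexProjectivePlane`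
(`Literature/Topology/FourManifolds/ComplexProjectiveSpace.lean`), and its transport along a
diffeomorphism of pairs. Here:

* `Ψ = affineChart 2`, `[v] ↦ (v₀/v₂, v₁/v₂)` realified, is a diffeomorphism `ℂℙ² ∖ L → ℝ⁴`
  (smooth, injective, onto, bijective differential — it is a chart with target `ℝ⁴`);
* `Θ [v] = fromC2 (bdC v)`, `bdC v = v̄₂ (v₀, v₁) / (|v₀|² + |v₁|²)` (the tree's blow-down
  coordinates, `ToricBlowupProjectivePlane.lean`: `ℂℙ² ∖ {q}` is the total space of `O(1)`), is
  smooth on `W = ℂℙ² ∖ {q}`, `q = [0:0:1]`, `W ⊇ L` (chart expressions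
  `[1 : a : b] ↦ b̄ • (1, a)/(1 + |a|²)`, `[c : 1 : d] ↦ d̄ • (c, 1)/(|c|² + 1)`), vanishes on `L`,
  and equals `ι ∘ Ψ` off `L`: `ι (v₀/v₂, v₁/v₂) = |v₂|² (v₀/v₂, v₁/v₂)/(|v₀|² + |v₁|²) = bdC v`.

No new definitions: `Θ` enters the lemmas as a variable with its defining equation `hΘ`
(discharged by `rfl` for `Projectivization.lift (fromC2 ∘ bdC)` in the sequel).
-/

noncomputable section

-- the prescribed namespace `Summit.<P>.<Sub>.…` duplicates `SmoothPoincare4` (P = Sub)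
set_option linter.dupNamespace false

open scoped Manifold ContDiff Topology ComplexConjugate
open Set Function Module Complex
open Literature.Topology.FourManifolds ComplexProjectiveSpace ToricBlowup
open Literature.Topology.FourManifolds.SphereCoord (contDiff_normSq)

namespace Summit.SmoothPoincare4.SmoothPoincare4.Theorems.McDuffWendlModel

/-- Model space `ℝ⁴`. -/
local notation "𝔼⁴" => EuclideanSpace ℝ (Fin 4)
/-- The complex projective plane of the tree. -/
local notation "ℙ²" => ComplexProjectivePlane
/-- The affine chart `i` of `ℂℙ²` at the literal model `ℝ⁴`. -/
local notation "𝔸" i:arg => (affineChart (n := 2) i : OpenPartialHomeomorph ComplexProjectivePlane 𝔼⁴)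

/-! ### The line `L = {v₂ = 0}`, the puncture `q = [0:0:1]`, the open set `W = ℂℙ² ∖ {q}` -/

/-- A point of the line `{v₂ = 0}` is not `q = [0:0:1]`. -/
theorem ne_qPt_of_not_coordNeZero {y : ℙ²} (hy : ¬ CoordNeZero 2 y) : y ≠ qPt := by
  induction y using ind with
  | h v =>
    rw [mk_eq_pt]
    intro h
    obtain ⟨h0, h1⟩ := (pt_eq_qPt_iff v.2).1 h
    have h2 : (v : Fin 3 → ℂ) 2 = 0 := not_not.1 hy
    exact v.2 (by funext j; fin_cases j <;> assumption)

/-- The complement of the line is the source `{v₂ ≠ 0}` of the affine chart `2`. -/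
theorem compl_line_eq : {y : ℙ² | ¬ CoordNeZero 2 y}ᶜ = {y : ℙ² | CoordNeZero 2 y} := by
  ext y; simp

/-! ### `Ψ`: the affine chart `2` is a diffeomorphism of `ℂℙ² ∖ L` onto `ℝ⁴` -/

/-- The affine chart `2` is smooth on the complement of the line. -/
theorem contMDiffOn_affineChart_two :
    ContMDiffOn (𝓡 4) 𝓘(ℝ, 𝔼⁴) ∞ (𝔸 2) {y : ℙ² | ¬ CoordNeZero 2 y}ᶜ := by
  rw [compl_line_eq]
  exact fun y hy => (contMDiffAt_affineChart hy).contMDiffWithinAt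

/-- The affine chart `2` is injective on the complement of the line (its source). -/
theorem injOn_affineChart_two : InjOn (𝔸 2) {y : ℙ² | ¬ CoordNeZero 2 y}ᶜ := by
  rw [compl_line_eq]
  exact (affineChart (n := 2) 2).injOn

/-- The affine chart `2` maps the complement of the line ONTO `ℝ⁴`. -/
theorem image_affineChart_two : (𝔸 2) '' {y : ℙ² | ¬ CoordNeZero 2 y}ᶜ = univ := by
  rw [compl_line_eq]
  exact (affineChart (n := 2) 2).image_source_eq_target

/-- The differential of the affine chart `2` is bijective at every point of its source. -/
theorem bijective_mfderiv_affineChart_two {y : ℙ²} (hy : y ∈ {y : ℙ² | ¬ CoordNeZero 2 y}ᶜ) :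
    Bijective (mfderiv (𝓡 4) 𝓘(ℝ, 𝔼⁴) (𝔸 2) y) := by
  rw [compl_line_eq] at hy
  have he : (𝔸 2) ∈ atlas 𝔼⁴ ℙ² := ⟨2, rfl⟩
  exact (mdifferentiable_of_mem_atlas (I := 𝓡 4) he).mfderiv_bijective hy

/-- The affine chart `2` in homogeneous coordinates: `[v] ↦ fromC2 (v₀/v₂, v₁/v₂)`. -/
theorem affineChart_two_pt (v : Fin 3 → ℂ) (hv : v ≠ 0) :
    (𝔸 2) (pt v hv) = fromC2 (v 0 / v 2, v 1 / v 2) := by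
  change realCoordinates 2 (affineCoordComplex 2 (mk ⟨v, hv⟩)) = _
  rw [affineCoordComplex_mk]
  ext m
  fin_cases m <;> rfl

/-! ### `Θ`: the blow-down coordinates `[v] ↦ v̄₂ (v₀, v₁) / (|v₀|² + |v₁|²)` realified -/

section Theta

variable (Θ : ℙ² → 𝔼⁴) (hΘ : ∀ (v : Fin 3 → ℂ) (hv : v ≠ 0), Θ (pt v hv) = fromC2 (bdC v))
include hΘ

/-- `Θ` in the affine chart `0`: `[1 : a : b] ↦ b̄ • (1, a) / (1 + |a|²)`. -/
theorem theta_affine₀ (w : 𝔼⁴) : Θ ((𝔸 0).symm w) =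
    fromC2 (conj (toC2 w).2 • ((((1 + normSq (toC2 w).1 : ℝ) : ℂ))⁻¹,
      (toC2 w).1 * (((1 + normSq (toC2 w).1 : ℝ) : ℂ))⁻¹)) := by
  rw [affineChart_zero_symm, hΘ]
  congr 1
  simp only [bdC, Fin.isValue, Matrix.cons_val_zero, Matrix.cons_val_one, Matrix.cons_val,
    map_one, mul_one, Prod.smul_mk, smul_eq_mul]
  push_cast
  ring_nf

/-- `Θ` in the affine chart `1`: `[c : 1 : d] ↦ d̄ • (c, 1) / (|c|² + 1)`. -/
theorem theta_affine₁ (w : 𝔼⁴) : Θ ((𝔸 1).symm w) =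
    fromC2 (conj (toC2 w).2 • ((toC2 w).1 * (((normSq (toC2 w).1 + 1 : ℝ) : ℂ))⁻¹,
      (((normSq (toC2 w).1 + 1 : ℝ) : ℂ))⁻¹)) := by
  rw [affineChart_one_symm, hΘ]
  congr 1
  simp only [bdC, Fin.isValue, Matrix.cons_val_zero, Matrix.cons_val_one, Matrix.cons_val,
    map_one, mul_one, Prod.smul_mk, smul_eq_mul]
  push_cast
  ring_nf

omit hΘ in
/-- The chart-`0` expression of `Θ` is smooth on `ℝ⁴`. -/
theorem contDiff_theta_chart₀ : ContDiff ℝ ∞ fun w : 𝔼⁴ =>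
    fromC2 (conj (toC2 w).2 • ((((1 + normSq (toC2 w).1 : ℝ) : ℂ))⁻¹,
      (toC2 w).1 * (((1 + normSq (toC2 w).1 : ℝ) : ℂ))⁻¹)) := by
  have hu : ContDiff ℝ ∞ fun w : 𝔼⁴ => (toC2 w).1 := contDiff_fst.comp contDiff_toC2
  have hv : ContDiff ℝ ∞ fun w : 𝔼⁴ => (toC2 w).2 := contDiff_snd.comp contDiff_toC2
  have hn : ContDiff ℝ ∞ fun w : 𝔼⁴ => (((1 + normSq (toC2 w).1 : ℝ) : ℂ)) :=
    ofRealCLM.contDiff.comp (contDiff_const.add (contDiff_normSq.comp hu))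
  have h0 : ∀ w : 𝔼⁴, (((1 + normSq (toC2 w).1 : ℝ) : ℂ)) ≠ 0 := fun w =>
    ofReal_ne_zero.2 (add_pos_of_pos_of_nonneg one_pos (normSq_nonneg _)).ne'
  exact contDiff_fromC2.comp
    ((conjCLE.contDiff.comp hv).smul ((hn.inv h0).prodMk (hu.mul (hn.inv h0))))

omit hΘ in
/-- The chart-`1` expression of `Θ` is smooth on `ℝ⁴`. -/
theorem contDiff_theta_chart₁ : ContDiff ℝ ∞ fun w : 𝔼⁴ =>
    fromC2 (conj (toC2 w).2 • ((toC2 w).1 * (((normSq (toC2 w).1 + 1 : ℝ) : ℂ))⁻¹,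
      (((normSq (toC2 w).1 + 1 : ℝ) : ℂ))⁻¹)) := by
  have hu : ContDiff ℝ ∞ fun w : 𝔼⁴ => (toC2 w).1 := contDiff_fst.comp contDiff_toC2
  have hv : ContDiff ℝ ∞ fun w : 𝔼⁴ => (toC2 w).2 := contDiff_snd.comp contDiff_toC2
  have hn : ContDiff ℝ ∞ fun w : 𝔼⁴ => (((normSq (toC2 w).1 + 1 : ℝ) : ℂ)) :=
    ofRealCLM.contDiff.comp ((contDiff_normSq.comp hu).add contDiff_const)
  have h0 : ∀ w : 𝔼⁴, (((normSq (toC2 w).1 + 1 : ℝ) : ℂ)) ≠ 0 := fun w =>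
    ofReal_ne_zero.2 (add_pos_of_nonneg_of_pos (normSq_nonneg _) one_pos).ne'
  exact contDiff_fromC2.comp
    ((conjCLE.contDiff.comp hv).smul ((hu.mul (hn.inv h0)).prodMk (hn.inv h0)))

omit hΘ in
/-- A point other than `q` lies in the affine chart `0` or in the affine chart `1`. -/
theorem coordNeZero_one_of_ne_qPt {y : ℙ²} (hy : y ≠ qPt) (h0 : ¬ CoordNeZero 0 y) :
    CoordNeZero 1 y := by
  induction y using ind with
  | h v =>
    rw [mk_eq_pt] at hy
    by_contra h1
    exact hy ((pt_eq_qPt_iff _).2 ⟨not_not.1 h0, not_not.1 h1⟩)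

/-- Near a point of the affine chart `0`, `Θ` is its chart-`0` expression after the chart. -/
theorem theta_eventuallyEq_chart₀ {y : ℙ²} (h0 : CoordNeZero 0 y) :
    Θ =ᶠ[𝓝 y] (fun w : 𝔼⁴ => fromC2 (conj (toC2 w).2 • ((((1 + normSq (toC2 w).1 : ℝ) : ℂ))⁻¹,
      (toC2 w).1 * (((1 + normSq (toC2 w).1 : ℝ) : ℂ))⁻¹))) ∘ (𝔸 0) := by
  filter_upwards [(affineChart (n := 2) 0).open_source.mem_nhds h0] with y' hy'
  simp only [comp_apply]
  conv_lhs => rw [← (affineChart (n := 2) 0).left_inv hy']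
  exact theta_affine₀ Θ hΘ _

/-- Near a point of the affine chart `1`, `Θ` is its chart-`1` expression after the chart. -/
theorem theta_eventuallyEq_chart₁ {y : ℙ²} (h1 : CoordNeZero 1 y) :
    Θ =ᶠ[𝓝 y] (fun w : 𝔼⁴ => fromC2 (conj (toC2 w).2 • ((toC2 w).1 *
      (((normSq (toC2 w).1 + 1 : ℝ) : ℂ))⁻¹, (((normSq (toC2 w).1 + 1 : ℝ) : ℂ))⁻¹))) ∘ (𝔸 1) := by
  filter_upwards [(affineChart (n := 2) 1).open_source.mem_nhds h1] with y' hy'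
  simp only [comp_apply]
  conv_lhs => rw [← (affineChart (n := 2) 1).left_inv hy']
  exact theta_affine₁ Θ hΘ _

/-- **`Θ` is smooth off `q = [0:0:1]`.** -/
theorem contMDiffAt_theta {y : ℙ²} (hy : y ≠ qPt) : ContMDiffAt (𝓡 4) 𝓘(ℝ, 𝔼⁴) ∞ Θ y := by
  by_cases h0 : CoordNeZero 0 y
  · refine ContMDiffAt.congr_of_eventuallyEq ?_ (theta_eventuallyEq_chart₀ Θ hΘ h0)
    exact contDiff_theta_chart₀.contMDiff.contMDiffAt.comp y (contMDiffAt_affineChart h0)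
  · have h1 := coordNeZero_one_of_ne_qPt hy h0
    refine ContMDiffAt.congr_of_eventuallyEq ?_ (theta_eventuallyEq_chart₁ Θ hΘ h1)
    exact contDiff_theta_chart₁.contMDiff.contMDiffAt.comp y (contMDiffAt_affineChart h1)

/-- `Θ` is smooth on `W = ℂℙ² ∖ {q}`. -/
theorem contMDiffOn_theta : ContMDiffOn (𝓡 4) 𝓘(ℝ, 𝔼⁴) ∞ Θ {y : ℙ² | y ≠ qPt} :=
  fun _ hy => (contMDiffAt_theta Θ hΘ hy).contMDiffWithinAt

/-- `Θ` vanishes on the line `{v₂ = 0}`. -/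
theorem theta_eq_zero_of_line {y : ℙ²} (hy : ¬ CoordNeZero 2 y) : Θ y = 0 := by
  induction y using ind with
  | h v =>
    have h2 : (v : Fin 3 → ℂ) 2 = 0 := not_not.1 hy
    rw [mk_eq_pt, hΘ, ← fromC2_zero]
    congr 1
    simp [bdC, h2]

omit hΘ in
/-- Real dilations commute with `fromC2`: `r • fromC2 (u, w) = fromC2 (r u, r w)`. -/
theorem smul_fromC2 (r : ℝ) (p : ℂ × ℂ) :
    r • fromC2 p = fromC2 ((r : ℂ) * p.1, (r : ℂ) * p.2) := by
  apply toC2_injective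
  rw [toC2_smul, toC2_fromC2, toC2_fromC2]

omit hΘ in
/-- The algebra behind `Θ = ι ∘ Ψ`: `v̄₂ vⱼ / (|v₀|² + |v₁|²) = r · (vⱼ / v₂)` with
`r = (|v₀/v₂|² + |v₁/v₂|²)⁻¹`, for `v₂ ≠ 0`. -/
theorem bdC_eq_inv_mul_div (v : Fin 3 → ℂ) (h2 : v 2 ≠ 0) :
    bdC v = ((((normSq (v 0 / v 2) + normSq (v 1 / v 2))⁻¹ : ℝ) : ℂ) * (v 0 / v 2),
      (((normSq (v 0 / v 2) + normSq (v 1 / v 2))⁻¹ : ℝ) : ℂ) * (v 1 / v 2)) := by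
  by_cases hN : normSq (v 0) + normSq (v 1) = 0
  · have h0 : v 0 = 0 := normSq_eq_zero.1 (by nlinarith [normSq_nonneg (v 0), normSq_nonneg (v 1)])
    have h1 : v 1 = 0 := normSq_eq_zero.1 (by nlinarith [normSq_nonneg (v 0), normSq_nonneg (v 1)])
    simp [bdC, h0, h1]
  · have hN' : ((normSq (v 0) : ℂ)) + (normSq (v 1) : ℂ) ≠ 0 := by exact_mod_cast hN
    have hn2 : ((normSq (v 2) : ℝ) : ℂ) ≠ 0 := by exact_mod_cast (normSq_pos.2 h2).ne'
    have hc2 : conj (v 2) ≠ 0 := (map_ne_zero _).2 h2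
    have key : ((normSq (v 2) : ℝ) : ℂ) = conj (v 2) * v 2 := normSq_eq_conj_mul_self
    simp only [bdC, map_div₀]
    push_cast
    rw [key]
    refine Prod.ext ?_ ?_ <;> dsimp only <;> field_simp

/-- **`Θ = ι ∘ Ψ` off the line**: on `{v₂ ≠ 0}`, `Θ` is the inversion in the unit sphere of the
affine chart `2`. -/
theorem theta_eq_sphereInversion {y : ℙ²} (hy : CoordNeZero 2 y) :
    Θ y = sphereInversion ((𝔸 2) y) := by
  induction y using ind with
  | h v =>
    have h2 : (v : Fin 3 → ℂ) 2 ≠ 0 := hy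
    rw [mk_eq_pt, hΘ, affineChart_two_pt, sphereInversion, norm_fromC2_sq, smul_fromC2,
      bdC_eq_inv_mul_div _ h2]

end Theta

end Summit.SmoothPoincare4.SmoothPoincare4.Theorems.McDuffWendlModel
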